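import Summits.CriticalPhenomena.SAWScalingLimit.Theorems.SAWLoopFugacityFlowIsingBoundaryRatioWindowCrossingCells
import Literature.Probability.RandomPlanarGeometry.CaratheodoryHalfPlaneProofs
import HarnessLib

/-!
# Radial crossings pass through the window rectangle — the chart semicircle and its descent to `∂D`
(line `fk-anchor-transfer`, crux `IsingBoundaryRatio`, stmt-CriticalPhenomena-10650; second helper module of the
proof of `AnnCrossThroughWindowRect`)

* `exists_chart_pair` — the two Carathéodory extensions at once: `g` of `φ⁻¹` to `closure D ∖ {b}`
  (`exists_chart_extension`) and `f = φ.boundaryExtension` of `φ` to the closed upper half-plane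
  (`JordanDomain.continuousOn_boundaryExtension_holds`), with `g ∘ f = id` on a closed half-disc, whose `f`-image
  stays at positive distance from `b`, real points going to `∂D`;
* `exists_quarterArc` — the image under `f` of a quarter of the chart circle `|w| = r` from the top `f (i r)` down
  to `∂D`, as a path, with its chart bookkeeping;
* `exists_descent` — pure plane topology: a path from a point of the open set
  `V = D ∖ ⋃ (closed non-perfect cells)` to a point off `D`, cut at its first exit from `V`, is prolonged inside
  one non-perfect cell by a mesh-avoiding access path (`Mesh.exists_accessPath`) and cut at its first exit from
  `D`: every point of the result is on the initial piece or avoids the mesh within `6δ` of the exit point;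
* `mul_re_neg_of_dist_lt` — sign of a real chart value near a chart point of radius `r` in a closed quadrant.

References: Ch. Pommerenke, *Boundary Behaviour of Conformal Maps* (1992), Thm. 2.1/2.6 [`PommerenkeBBCM1992`].
-/

noncomputable section

open scoped Classical Topology
open Filter Set Metric SimpleGraph Complex
open Literature.Probability.LatticeModels Literature.Probability.RandomPlanarGeometry
open Literature.Probability.Percolation (BondConfig)
open Literature.Topology.PlaneTopology
open UpperHalfPlane (upperHalfPlaneSet)

namespace Summit.CriticalPhenomena.SAWScalingLimit.Theorems.IsingBoundaryRatio

/-! ### The two Carathéodory extensions -/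

set_option maxHeartbeats 400000 in
/-- **The chart pair.** For a chordal uniformizing map `φ` of `(D; a, b)` and `R > 0`: the extension `g` of
`φ⁻¹` to `closure D ∖ {b}` (continuous, injective, real on `∂D`, `g a = 0`), a distance `d > 0` from `b` kept by
all points of chart radius `≤ R`, and the extension `f` of `φ` to the closed upper half-plane (continuous, equal to
`φ` on `ℍ`, real points to `∂D`) with, on the closed half-disc of radius `R`: `f w ∈ closure D`,
`dist (f w) b ≥ d` and `g (f w) = w`. [cite: PommerenkeBBCM1992, Thm. 2.6] -/
theorem exists_chart_pair {D : DobrushinDomain} {φ : ConformalEquiv upperHalfPlaneSet D.carrier}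
    (hφ : D.IsChordalUniformizing φ) (R : ℝ) :
    ∃ (g f : ℂ → ℂ) (d : ℝ), 0 < d ∧
      ContinuousOn g (closure D.carrier \ {D.pt 1}) ∧ EqOn g φ.symm D.carrier ∧
      (∀ z ∈ frontier D.carrier, z ≠ D.pt 1 → (g z).im = 0) ∧ InjOn g (closure D.carrier \ {D.pt 1}) ∧
      g (D.pt 0) = 0 ∧
      (∀ z ∈ D.carrier, ‖φ.symm z‖ ≤ R → d ≤ dist z (D.pt 1)) ∧
      ContinuousOn f {w : ℂ | 0 ≤ w.im} ∧ (∀ w : ℂ, 0 < w.im → f w = φ w ∧ f w ∈ D.carrier) ∧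
      (∀ w : ℂ, 0 ≤ w.im → ‖w‖ ≤ R → f w ∈ closure D.carrier ∧ d ≤ dist (f w) (D.pt 1) ∧ g (f w) = w) ∧
      (∀ w : ℂ, w.im = 0 → f w ∈ frontier D.carrier) := by
  obtain ⟨g, hgc, hgeq, hgreal, hginj, hga⟩ := exists_chart_extension hφ
  obtain ⟨d, hd, hdball⟩ := Metric.mem_nhdsWithin_iff.1
    (hφ.tendsto_symm_cocompact ((isCompact_closedBall (0 : ℂ) (R + 1)).compl_mem_cocompact))
  have hfar : ∀ z ∈ D.carrier, ‖φ.symm z‖ ≤ R + 1 → d ≤ dist z (D.pt 1) := by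
    intro z hz hzr
    by_contra h
    push Not at h
    have := hdball ⟨Metric.mem_ball.2 h, hz⟩
    simp only [mem_preimage, mem_compl_iff, mem_closedBall, dist_zero_right, not_le] at this
    linarith
  set f := φ.boundaryExtension with hf
  have hcl : closure upperHalfPlaneSet = {w : ℂ | 0 ≤ w.im} :=
    Set.ext fun w => mem_closure_upperHalfPlaneSet_iff
  have hfc : ContinuousOn f {w : ℂ | 0 ≤ w.im} :=
    hcl ▸ JordanDomain.continuousOn_boundaryExtension_holds D.toJordanDomain φ
  have hfmaps : MapsTo f {w : ℂ | 0 ≤ w.im} (closure D.carrier) :=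
    hcl ▸ JordanDomain.mapsTo_boundaryExtension_holds D.toJordanDomain φ
  have hfpos : ∀ w : ℂ, 0 < w.im → f w = φ w ∧ f w ∈ D.carrier := fun w hw =>
    ⟨φ.boundaryExtension_eq hw, by rw [show f w = φ w from φ.boundaryExtension_eq hw]; exact φ.mapsTo hw⟩
  have hfreal : ∀ w : ℂ, w.im = 0 → f w ∈ frontier D.carrier := by
    intro w hw
    obtain ⟨p, hp, hbv⟩ := JordanDomain.exists_hasBoundaryValue_holds D.toJordanDomain φ w.re
    have hw' : ((w.re : ℝ) : ℂ) = w := Complex.ext (by simp) (by simp [hw])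
    rw [← hw', hf, φ.boundaryExtension_eq_of_hasBoundaryValue (by rw [hcl]; simp) hbv]
    exact hp
  -- the closed half-disc as part of the closure of `s`
  set s : Set ℂ := {w : ℂ | 0 < w.im ∧ ‖w‖ ≤ R + 1} with hs
  have hcls : closure s ⊆ {w : ℂ | 0 ≤ w.im} := by
    rw [← hcl]; exact closure_mono fun w hw => hw.1
  have hsdist : ∀ w ∈ s, d ≤ dist (f w) (D.pt 1) := fun w hw => by
    rw [(hfpos w hw.1).1]
    exact hfar _ (φ.mapsTo hw.1) (by rw [φ.symm_apply_apply hw.1]; exact hw.2)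
  have hcdist : ∀ w ∈ closure s, d ≤ dist (f w) (D.pt 1) := fun w hw =>
    le_on_closure (f := fun _ => d) (g := fun w => dist (f w) (D.pt 1)) hsdist continuousOn_const
      ((continuous_id.dist continuous_const).comp_continuousOn (hfc.mono hcls)) hw
  have hgf : EqOn (fun w => g (f w)) id (closure s) := by
    refine EqOn.of_subset_closure (s := s) ?_ ?_ continuousOn_id subset_closure Subset.rfl
    · intro w hw
      show g (f w) = w
      rw [(hfpos w hw.1).1, hgeq (φ.mapsTo hw.1), φ.symm_apply_apply hw.1]
    · refine hgc.comp (hfc.mono hcls) fun w hw => ⟨hfmaps (hcls hw), fun h => ?_⟩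
      have := hcdist w hw
      rw [mem_singleton_iff] at h
      rw [h, _root_.dist_self] at this
      linarith
  have hmem : ∀ w : ℂ, 0 ≤ w.im → ‖w‖ ≤ R → w ∈ closure s := by
    intro w hw hwR
    set u : ℕ → ℝ := fun n => 1 / ((n : ℝ) + 1) with hu
    have h1 : Tendsto u atTop (𝓝 0) := tendsto_one_div_add_atTop_nhds_zero_nat
    have h2 : Tendsto (fun n => ((u n : ℝ) : ℂ) * I) atTop (𝓝 0) := by
      have := ((Complex.continuous_ofReal.tendsto 0).comp h1).mul_const I
      simpa using this
    have htend : Tendsto (fun n => w + ((u n : ℝ) : ℂ) * I) atTop (𝓝 w) := by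
      simpa using tendsto_const_nhds.add h2
    refine mem_closure_of_tendsto htend (Eventually.of_forall fun n => ⟨?_, ?_⟩)
    · have hun : 0 < u n := by rw [hu]; positivity
      simp only [add_im, mul_im, ofReal_re, I_im, mul_one, ofReal_im, I_re, mul_zero, add_zero]
      linarith
    · have hun1 : u n ≤ 1 := by
        rw [hu, div_le_one (by positivity)]
        linarith [n.cast_nonneg (α := ℝ)]
      have hun0 : 0 ≤ u n := by rw [hu]; positivity
      calc ‖w + ((u n : ℝ) : ℂ) * I‖ ≤ ‖w‖ + ‖((u n : ℝ) : ℂ) * I‖ := norm_add_le _ _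
        _ = ‖w‖ + u n := by rw [norm_mul, norm_I, mul_one, norm_real, Real.norm_eq_abs, abs_of_nonneg hun0]
        _ ≤ R + 1 := by linarith
  refine ⟨g, f, d, hd, hgc, hgeq, hgreal, hginj, hga, fun z hz hzR => hfar z hz (by linarith), hfc, hfpos,
    fun w hw hwR => ?_, hfreal⟩
  have hws := hmem w hw hwR
  exact ⟨hfmaps (hcls hws), hcdist w hws, hgf hws⟩

/-! ### Quarter arcs of the chart circle -/

/-- **Quarter arc.** The `f`-image of the quarter of the chart circle `|w| = r` from the top `i r` down to the
real axis (`σ = 1`: the quarter ending at `-r`; `σ = -1`: the one ending at `+r`), as a path from `f (r i)` to a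
point of `∂D`; along it the chart value `g` has modulus `r`, `σ · re ≤ 0` and `im ≥ 0`, and the points lie in
`closure D` at distance `≥ d` from `b`. [folklore] -/
theorem exists_quarterArc {D : DobrushinDomain} {g f : ℂ → ℂ} {d R r σ : ℝ}
    (hfc : ContinuousOn f {w : ℂ | 0 ≤ w.im})
    (hdisk : ∀ w : ℂ, 0 ≤ w.im → ‖w‖ ≤ R → f w ∈ closure D.carrier ∧ d ≤ dist (f w) (D.pt 1) ∧ g (f w) = w)
    (hreal : ∀ w : ℂ, w.im = 0 → f w ∈ frontier D.carrier) (hr : 0 < r) (hrR : r ≤ R) (hσ : σ = 1 ∨ σ = -1) :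
    ∃ (q : ℂ) (c : Path (f (r * I)) q), q ∈ frontier D.carrier ∧
      ∀ y ∈ range c, y ∈ closure D.carrier ∧ d ≤ dist y (D.pt 1) ∧ ‖g y‖ = r ∧ σ * (g y).re ≤ 0 ∧
        0 ≤ (g y).im := by
  set θ : ℝ → ℝ := fun t => Real.pi / 2 + σ * t * (Real.pi / 2) with hθ
  set w : ℝ → ℂ := fun t => (r : ℂ) * exp ((θ t : ℂ) * I) with hw
  have hwc : Continuous w := by
    simp only [hw, hθ]
    fun_prop
  have hθmem : ∀ t ∈ Icc (0 : ℝ) 1, 0 ≤ θ t ∧ θ t ≤ Real.pi ∧ σ * Real.cos (θ t) ≤ 0 := by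
    intro t ht
    have hpi := Real.pi_pos
    rcases hσ with rfl | rfl
    · have h1 : Real.pi / 2 ≤ θ t := by simp only [hθ]; nlinarith [ht.1]
      have h2 : θ t ≤ Real.pi := by simp only [hθ]; nlinarith [ht.2]
      refine ⟨by linarith, h2, ?_⟩
      rw [one_mul]
      exact Real.cos_nonpos_of_pi_div_two_le_of_le h1 (by linarith)
    · have h1 : 0 ≤ θ t := by simp only [hθ]; nlinarith [ht.2]
      have h2 : θ t ≤ Real.pi / 2 := by simp only [hθ]; nlinarith [ht.1]
      refine ⟨h1, by linarith, ?_⟩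
      have : 0 ≤ Real.cos (θ t) := Real.cos_nonneg_of_mem_Icc ⟨by linarith, h2⟩
      linarith
  have hwnorm : ∀ t, ‖w t‖ = r := fun t => by
    rw [hw]; simp only [norm_mul, norm_real, Real.norm_eq_abs, abs_of_pos hr, norm_exp_ofReal_mul_I, mul_one]
  have hwre : ∀ t, (w t).re = r * Real.cos (θ t) := fun t => by
    simp only [hw, re_ofReal_mul, exp_ofReal_mul_I_re]
  have hwim : ∀ t, (w t).im = r * Real.sin (θ t) := fun t => by
    simp only [hw, im_ofReal_mul, exp_ofReal_mul_I_im]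
  have hwim0 : ∀ t ∈ Icc (0 : ℝ) 1, 0 ≤ (w t).im := fun t ht => by
    rw [hwim]
    obtain ⟨h1, h2, -⟩ := hθmem t ht
    exact mul_nonneg hr.le (Real.sin_nonneg_of_nonneg_of_le_pi h1 h2)
  have hw0 : w 0 = r * I := by
    simp only [hw, hθ, mul_zero, zero_mul, add_zero]
    rw [exp_mul_I]
    push_cast
    rw [Complex.cos_pi_div_two, Complex.sin_pi_div_two]
    ring
  have hw1 : (w 1).im = 0 := by
    rw [hwim]
    rcases hσ with rfl | rfl
    · simp only [hθ, one_mul, add_halves, Real.sin_pi, mul_zero]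
    · norm_num [hθ]
  set c : Path (f (r * I)) (f (w 1)) :=
    { toFun := fun t => f (w t)
      continuous_toFun := hfc.comp_continuous (hwc.comp continuous_subtype_val) fun t => hwim0 t t.2
      source' := by show f (w 0) = f (r * I); rw [hw0]
      target' := rfl } with hc
  refine ⟨f (w 1), c, hreal _ hw1, ?_⟩
  rintro y ⟨t, rfl⟩
  show f (w t) ∈ closure D.carrier ∧ d ≤ dist (f (w t)) (D.pt 1) ∧ ‖g (f (w t))‖ = r ∧
    σ * (g (f (w t))).re ≤ 0 ∧ 0 ≤ (g (f (w t))).im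
  obtain ⟨h1, h2, h3⟩ := hdisk (w t) (hwim0 t t.2) ((hwnorm t).le.trans hrR)
  rw [h3, hwnorm, hwre, hwim]
  obtain ⟨h4, h5, h6⟩ := hθmem t t.2
  refine ⟨h1, h2, rfl, ?_, mul_nonneg hr.le (Real.sin_nonneg_of_nonneg_of_le_pi h4 h5)⟩
  have : σ * (r * Real.cos (θ t)) = r * (σ * Real.cos (θ t)) := by ring
  rw [this]
  exact mul_nonpos_of_nonneg_of_nonpos hr.le h6

/-- **Sign of a nearby real chart value.** A real number `x` within `m ≤ r` of a point `G` of modulus `r`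
with `σ · re G ≤ 0` (`σ = ±1`) has `σ · x < 0`. [folklore] -/
theorem mul_re_neg_of_dist_lt {x G : ℂ} {r m σ : ℝ} (hm : m ≤ r) (hG : ‖G‖ = r) (hσ : σ = 1 ∨ σ = -1)
    (hGre : σ * G.re ≤ 0) (hx : x.im = 0) (hd : dist x G < m) : σ * x.re < 0 := by
  have h1 : ‖x - G‖ ^ 2 = (x.re - G.re) ^ 2 + (x.im - G.im) ^ 2 := by
    rw [← normSq_eq_norm_sq, normSq_apply, sub_re, sub_im]; ring
  have h2 : r ^ 2 = G.re ^ 2 + G.im ^ 2 := by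
    rw [← hG, ← normSq_eq_norm_sq, normSq_apply]; ring
  rw [dist_eq_norm] at hd
  have h3 : ‖x - G‖ ^ 2 < m ^ 2 := by
    have h0 : 0 ≤ ‖x - G‖ := norm_nonneg _
    nlinarith
  rw [hx, zero_sub, even_two.neg_pow] at h1
  by_contra hcon
  push Not at hcon
  have h4 : G.re ^ 2 ≤ (x.re - G.re) ^ 2 := by
    rcases hσ with rfl | rfl
    · simp only [one_mul] at hGre hcon
      nlinarith
    · simp only [neg_mul, one_mul, neg_nonpos, Left.nonneg_neg_iff] at hGre hcon
      nlinarith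
  have hm0 : 0 < m := (norm_nonneg _).trans_lt hd
  nlinarith

/-! ### Descent to the boundary through a non-perfect cell -/

/-- **Descent.** Let `V = D ∖ ⋃_{q ∈ I₀} (closed cell q)` for finitely many NON-perfect cells, `c` a path inside
`closure D` from a point of `V` to a point off `D`. Cutting `c` at its first exit `p` from `V` and — unless `p`
is already on `∂D` — prolonging it inside a non-perfect cell at `p` by a mesh-avoiding access path to the
exterior, cut at the first exit `q ∈ ∂D` from `D`, gives a path `Γ` from the start to `q` each of whose points is
on the initial piece `Q` of `c` (all in `V` but its end `p`) or avoids the mesh within `6δ` of `p`; also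
`dist q p < 6δ`. [folklore] -/
theorem exists_descent (D : JordanDomain) {δ : ℝ} (hδ : 0 < δ) (I₀ : Finset (ℤ × ℤ))
    (hI₀ : ∀ q ∈ I₀, ¬ Mesh.IsPerfect D.carrier δ q.1 q.2) {z₀ q₀ : ℂ} (c : Path z₀ q₀)
    (hz₀ : z₀ ∈ D.carrier \ ⋃ q ∈ I₀, closure (Mesh.cell δ q.1 q.2))
    (hq₀ : q₀ ∉ D.carrier) (hc : range c ⊆ closure D.carrier) :
    ∃ (p : ℂ) (Q : Path z₀ p) (q : ℂ) (Γ : Path z₀ q),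
      range Q ⊆ range c ∧ p ∈ frontier (D.carrier \ ⋃ q ∈ I₀, closure (Mesh.cell δ q.1 q.2)) ∧
      (∀ t, Q t ∈ D.carrier \ ⋃ q ∈ I₀, closure (Mesh.cell δ q.1 q.2) ∨ Q t = p) ∧
      q ∈ frontier D.carrier ∧ dist q p < 6 * δ ∧ (∀ t, Γ t ∈ D.carrier ∨ Γ t = q) ∧
      ∀ y ∈ range Γ, y ∈ range Q ∨ (Mesh.AvoidsMesh D.carrier δ y ∧ dist y p < 6 * δ) := by
  set V : Set ℂ := D.carrier \ ⋃ q ∈ I₀, closure (Mesh.cell δ q.1 q.2) with hV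
  have hVo : IsOpen V := D.isOpen.sdiff (isClosed_biUnion_finset fun q _ => isClosed_closure)
  have hq₀V : q₀ ∉ V := fun h => hq₀ h.1
  obtain ⟨p, Q, hpfr, hQc, hQV⟩ := exists_firstExit c hVo hz₀ hq₀V
  have hpV : p ∉ V := by rw [hVo.frontier_eq] at hpfr; exact hpfr.2
  have hpQ : p ∈ range Q := ⟨1, Q.target⟩
  by_cases hcell : ∃ q ∈ I₀, p ∈ closure (Mesh.cell δ q.1 q.2)
  · obtain ⟨⟨k, j⟩, hkj, hpk⟩ := hcell
    obtain ⟨x, hxE, γ, hγA, hγd⟩ :=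
      Mesh.exists_accessPath D.isOpen D.frontier_subset_closure_exterior' hδ (hI₀ _ hkj)
    have hcen := Mesh.cellCenter_mem_cell hδ k j
    have hcen' : Mesh.cellCenter δ k j ∈ closure (Mesh.cell δ k j) := subset_closure hcen
    have hxD : x ∉ D.carrier := fun h => hxE (subset_closure h)
    set full : Path z₀ x := Q.trans ((Path.segment p (Mesh.cellCenter δ k j)).trans γ) with hfull
    obtain ⟨q, Γ, hq, hΓr, hΓD⟩ := exists_firstExit full D.isOpen hz₀.1 hxD
    have hfr : range full = range Q ∪ (segment ℝ p (Mesh.cellCenter δ k j) ∪ range γ) := by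
      simp only [hfull, Path.trans_range, Path.range_segment]
    have hcases : ∀ y ∈ range Γ, y ∈ range Q ∨ (Mesh.AvoidsMesh D.carrier δ y ∧ dist y p < 6 * δ) := by
      intro y hy
      have hy' := hΓr hy
      rw [hfr] at hy'
      rcases hy' with hy' | hy' | ⟨t, rfl⟩
      · exact Or.inl hy'
      · rcases Mesh.eq_or_eq_or_mem_openSegment hy' with rfl | rfl | h
        · exact Or.inl hpQ
        · refine Or.inr ⟨Mesh.avoidsMesh_of_mem_cell hδ hcen, ?_⟩
          linarith [dist_le_of_mem_closure_cell hδ hcen' hpk]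
        · rw [openSegment_symm] at h
          have hyc : y ∈ Mesh.cell δ k j := Mesh.openSegment_subset_cell_of_mem_closure k j hcen hpk h
          refine Or.inr ⟨Mesh.avoidsMesh_of_mem_cell hδ hyc, ?_⟩
          linarith [dist_le_of_mem_closure_cell hδ (subset_closure hyc) hpk]
      · refine Or.inr ⟨hγA t, ?_⟩
        linarith [hγd t, dist_triangle (γ t) (Mesh.cellCenter δ k j) p,
          dist_le_of_mem_closure_cell hδ hcen' hpk]
    refine ⟨p, Q, q, Γ, hQc, hpfr, hQV, hq, ?_, hΓD, hcases⟩
    rcases hcases q ⟨1, Γ.target⟩ with ⟨t, ht⟩ | h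
    · rcases hQV t with h | h
      · rw [ht] at h
        rw [IsOpen.frontier_eq D.isOpen] at hq
        exact absurd h.1 hq.2
      · rw [← ht, h, _root_.dist_self]; positivity
    · exact h.2
  · have hpD : p ∉ D.carrier := fun h => hpV ⟨h, fun hmem => hcell ?_⟩
    · have hpcl : p ∈ closure D.carrier := hc (hQc hpQ)
      have hpfrD : p ∈ frontier D.carrier := by
        rw [IsOpen.frontier_eq D.isOpen]; exact ⟨hpcl, hpD⟩
      refine ⟨p, Q, p, Q, hQc, hpfr, hQV, hpfrD, by rw [_root_.dist_self]; positivity, fun t => ?_, fun y hy => Or.inl hy⟩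
      rcases hQV t with h | h
      exacts [Or.inl h.1, Or.inr h]
    · obtain ⟨q, hq, hpq⟩ := mem_iUnion₂.1 hmem
      exact ⟨q, hq, hpq⟩

/-- Sign of a nearby real chart value, closed form (registered sub-goal of stmt-CriticalPhenomena-10650). [folklore] -/
theorem mul_re_neg_of_dist_lt' : ∀ {x G : ℂ} {r m σ : ℝ}, m ≤ r → ‖G‖ = r → (σ = 1 ∨ σ = -1) → σ * G.re ≤ 0 → x.im = 0 → dist x G < m → σ * x.re < 0 :=
  fun hm hG hσ hGre hx hd => mul_re_neg_of_dist_lt hm hG hσ hGre hx hd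

end Summit.CriticalPhenomena.SAWScalingLimit.Theorems.IsingBoundaryRatio

end
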